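import Literature.Topology.FourManifolds.TrisectionsTriNormalForm
import Summits.SmoothPoincare4.SmoothPoincare4.Theorems.CongruenceShadowsAgkCor6SufficiencySpineDefs

/-!
# Stub `stub_seamFlow` of line `lp-by-sphere-system-surgery` for crux `AgkCor6Sufficiency`, part 1:
# tubes and the explicit seam flow in the tube
(item stmt-SmoothPoincare4-10894; lead reshape r5, SF; registered helper stub `stub_seamFlowTubeToolkit`)

For a tube structure `(Ot, tp)` of a normal frame `(F, u, v, ρ, U, O)` (`TubeStructure`,
`NormalFrame`): the map `(z ↦ tp (ρ (f z)) (α z) (β z))` is smooth for smooth `f, α, β`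
(`contMDiffOn_tp_comp`, from the chart formula of `TubeStructure`), the closed tubes
`{x ∈ Ot | u² + v² ≤ s²}`, `s < rt`, are compact (`isCompact_closedTube`: continuous images of
`F × D̄_s`), so `closure T(s) ⊆ {x ∈ Ot | u² + v² ≤ s²}` (`closure_tubeSet_subset`); and the
EXPLICIT SEAM FLOW `tubeFlow m u v ρ tp x t = tp (ρ x) (u', v')`, `(p, q) ↦ (p, q - t / (2p))` in the
seam coordinates of seam `m`, with its algebra (`tubeFlow_spec`, `tubeFlow_zero`, `tubeFlow_add`,
`sq_tubeFlow_lt`) and its joint smoothness (`contMDiffOn_tubeFlow`).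

References: Abrams–Gay–Kirby, Geom. Topol. 22 (2018), proof of Thm. 5 [AbramsGayKirby2018];
Milnor, *Lectures on the h-cobordism theorem* (1965), proof of Thm. 3.4 [MilnorHCobordism1965].
-/

noncomputable section

set_option linter.dupNamespace false

namespace Summit.SmoothPoincare4.SmoothPoincare4.Cruxes.AgkCor6Sufficiency.LpBySphereSystemSurgery

open Set Function Filter
open scoped _root_.Manifold _root_.ContDiff _root_.Topology
open Literature.Topology.FourManifolds

/-! ## Table algebra of the seam coordinates -/

section Tables

/-- `u` is affine in `q` with slope `uOfPQ m 0 1`. -/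
theorem uOfPQ_sub (m : Fin 3) (p q s : ℝ) : uOfPQ m p (q - s) = uOfPQ m p q - s * uOfPQ m 0 1 := by
  fin_cases m <;> simp [uOfPQ]

/-- `v` is affine in `q` with slope `vOfPQ m 0 1`. -/
theorem vOfPQ_sub (m : Fin 3) (p q s : ℝ) : vOfPQ m p (q - s) = vOfPQ m p q - s * vOfPQ m 0 1 := by
  fin_cases m <;> simp [vOfPQ, sub_right_comm]

/-- The `q`-direction `(uOfPQ m 0 1, vOfPQ m 0 1)` is a unit vector of the `(u, v)`-plane. -/
theorem dir_sq (m : Fin 3) : uOfPQ m 0 1 ^ 2 + vOfPQ m 0 1 ^ 2 = 1 := by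
  fin_cases m <;> simp [uOfPQ, vOfPQ]

/-- On the seam ray (`q = 0`), `u² + v² ≤ 2 p²`. -/
theorem sq_ray_le (m : Fin 3) (p : ℝ) : uOfPQ m p 0 ^ 2 + vOfPQ m p 0 ^ 2 ≤ 2 * p ^ 2 := by
  fin_cases m <;> simp [uOfPQ, vOfPQ] <;> nlinarith [sq_nonneg p]

/-- Moving `(a, b)` by `s` along a unit direction changes the radius by at most `|s|`:
if `a² + b² < R²` and `|s| ≤ d` then `(a - s e₁)² + (b - s e₂)² < (R + d)²`. -/
theorem sq_shift_lt {a b e₁ e₂ s R d : ℝ} (he : e₁ ^ 2 + e₂ ^ 2 = 1) (hR : 0 ≤ R)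
    (hab : a ^ 2 + b ^ 2 < R ^ 2) (hs : |s| ≤ d) :
    (a - s * e₁) ^ 2 + (b - s * e₂) ^ 2 < (R + d) ^ 2 := by
  have hd : 0 ≤ d := (abs_nonneg s).trans hs
  -- Cauchy–Schwarz for the unit direction
  have hcs : (a * e₁ + b * e₂) ^ 2 ≤ a ^ 2 + b ^ 2 := by
    nlinarith [sq_nonneg (a * e₂ - b * e₁)]
  have hlt : |a * e₁ + b * e₂| < R := by
    have h1 : (a * e₁ + b * e₂) ^ 2 < R ^ 2 := hcs.trans_lt hab
    exact abs_lt_of_sq_lt_sq' h1 hR |> fun h => abs_lt.2 h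
  have h2 : -(2 * s * (a * e₁ + b * e₂)) ≤ 2 * d * R := by
    have : |2 * s * (a * e₁ + b * e₂)| ≤ 2 * d * R := by
      rw [abs_mul, abs_mul, abs_two]
      exact mul_le_mul (mul_le_mul_of_nonneg_left hs zero_le_two) hlt.le (abs_nonneg _)
        (by positivity)
    linarith [neg_abs_le (2 * s * (a * e₁ + b * e₂))]
  have h3 : s ^ 2 ≤ d ^ 2 := by
    have := sq_abs s; nlinarith [abs_nonneg s]
  have key : (a - s * e₁) ^ 2 + (b - s * e₂) ^ 2 =
      a ^ 2 + b ^ 2 - 2 * s * (a * e₁ + b * e₂) + s ^ 2 * (e₁ ^ 2 + e₂ ^ 2) := by ring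
  rw [key, he]
  nlinarith

/-- `pCo m` is a smooth function of `(u, v)`. -/
theorem contDiff_pCo (m : Fin 3) : ContDiff ℝ ∞ fun c : ℝ × ℝ => pCo m c.1 c.2 := by
  fin_cases m <;> simp [pCo] <;> fun_prop

/-- `qCo m` is a smooth function of `(u, v)`. -/
theorem contDiff_qCo (m : Fin 3) : ContDiff ℝ ∞ fun c : ℝ × ℝ => qCo m c.1 c.2 := by
  fin_cases m <;> simp [qCo] <;> fun_prop

/-- `uOfPQ m` is a smooth function of `(p, q)`. -/
theorem contDiff_uOfPQ (m : Fin 3) : ContDiff ℝ ∞ fun c : ℝ × ℝ => uOfPQ m c.1 c.2 := by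
  fin_cases m <;> simp [uOfPQ] <;> fun_prop

/-- `vOfPQ m` is a smooth function of `(p, q)`. -/
theorem contDiff_vOfPQ (m : Fin 3) : ContDiff ℝ ∞ fun c : ℝ × ℝ => vOfPQ m c.1 c.2 := by
  fin_cases m <;> simp [vOfPQ] <;> fun_prop

/-- A vector of `ℝ⁴` written in the standard basis. -/
theorem bang4_eq (a b c d : ℝ) : (!₂[a, b, c, d] : EuclideanSpace ℝ (Fin 4)) =
    a • EuclideanSpace.single 0 1 + b • EuclideanSpace.single 1 1 +
      c • EuclideanSpace.single 2 1 + d • EuclideanSpace.single 3 1 := by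
  ext i
  fin_cases i <;> simp

end Tables

/-! ## Smoothness of the tube parametrisation and compactness of closed tubes -/

section Tube

variable {X : Type} [TopologicalSpace X] [ChartedSpace (EuclideanSpace ℝ (Fin 4)) X]
  {S₀ F : Set X} {u v : X → ℝ} {ρ : X → X} {U O Ot : Set X} {rt : ℝ} {tp : X → ℝ → ℝ → X}

/-- Coordinate functions of `ℝ⁴` are smooth. -/
theorem contMDiff_proj4 (i : Fin 4) :
    ContMDiff 𝓘(ℝ, EuclideanSpace ℝ (Fin 4)) 𝓘(ℝ, ℝ) ∞ fun q : EuclideanSpace ℝ (Fin 4) => q i := by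
  rw [contMDiff_iff_contDiff]; exact contDiff_piLp_apply (p := 2) (i := i)

/-- **Smoothness of the tube parametrisation** (from the chart formula of `TubeStructure`): for
smooth `f` (into `O`), `α`, `β` with `α² + β² < rt²` on `s`, the map `z ↦ tp (ρ (f z)) (α z) (β z)`
is smooth on `s`. -/
theorem contMDiffOn_tp_comp (hTS : TubeStructure S₀ F u v ρ O Ot rt tp) (hfr : NormalFrame F u v ρ U O)
    {EN : Type*} [NormedAddCommGroup EN] [NormedSpace ℝ EN] {HN : Type*} [TopologicalSpace HN]
    {J : ModelWithCorners ℝ EN HN} {N : Type*} [TopologicalSpace N] [ChartedSpace HN N]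
    {f : N → X} {α β : N → ℝ} {s : Set N}
    (hf : ContMDiffOn J (𝓡 4) ∞ f s) (hα : ContMDiffOn J 𝓘(ℝ, ℝ) ∞ α s)
    (hβ : ContMDiffOn J 𝓘(ℝ, ℝ) ∞ β s) (hfO : ∀ z ∈ s, f z ∈ O)
    (hd : ∀ z ∈ s, α z ^ 2 + β z ^ 2 < rt ^ 2) :
    ContMDiffOn J (𝓡 4) ∞ (fun z => tp (ρ (f z)) (α z) (β z)) s := by
  intro z₀ hz₀
  have hp₀ : ρ (f z₀) ∈ F := hfr.ρ_mem _ (hfO z₀ hz₀)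
  obtain ⟨C, W, hWo, hp₀W, hWsrc, -, hCW⟩ := hTS.chart _ hp₀
  -- the smaller set on which the chart formula holds
  set s' : Set N := s ∩ (fun z => ρ (f z)) ⁻¹' W with hs'
  have hρf : ContMDiffOn J (𝓡 4) ∞ (fun z => ρ (f z)) s := hfr.contMDiff_ρ.comp_contMDiffOn hf
  have hs'n : s' ∈ 𝓝[s] z₀ := by
    have := (hρf z₀ hz₀).continuousWithinAt.preimage_mem_nhdsWithin (hWo.mem_nhds hp₀W)
    exact Filter.inter_mem self_mem_nhdsWithin this
  have hformula : ∀ z ∈ s', (!₂[α z, β z, C.Θ (ρ (f z)) 2, C.Θ (ρ (f z)) 3] :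
      EuclideanSpace ℝ (Fin 4)) ∈ C.Θ.target ∧
      tp (ρ (f z)) (α z) (β z) = C.Θ.symm (!₂[α z, β z, C.Θ (ρ (f z)) 2, C.Θ (ρ (f z)) 3]) :=
    fun z hz => hCW _ hz.2 (hfr.ρ_mem _ (hfO z hz.1)) _ _ (hd z hz.1)
  -- smoothness of the slice vector
  have hΘρf : ContMDiffOn J 𝓘(ℝ, EuclideanSpace ℝ (Fin 4)) ∞ (fun z => C.Θ (ρ (f z))) s' :=
    C.contMDiffOn_toFun.comp (hρf.mono inter_subset_left) fun z hz => hWsrc hz.2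
  have hslice : ContMDiffOn J 𝓘(ℝ, EuclideanSpace ℝ (Fin 4)) ∞
      (fun z => (!₂[α z, β z, C.Θ (ρ (f z)) 2, C.Θ (ρ (f z)) 3] : EuclideanSpace ℝ (Fin 4))) s' := by
    have h2 : ContMDiffOn J 𝓘(ℝ, ℝ) ∞ (fun z => C.Θ (ρ (f z)) 2) s' :=
      (contMDiff_proj4 2).comp_contMDiffOn hΘρf
    have h3 : ContMDiffOn J 𝓘(ℝ, ℝ) ∞ (fun z => C.Θ (ρ (f z)) 3) s' :=
      (contMDiff_proj4 3).comp_contMDiffOn hΘρf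
    simp only [bang4_eq]
    exact ((((hα.mono inter_subset_left).smul contMDiffOn_const).add
      ((hβ.mono inter_subset_left).smul contMDiffOn_const)).add (h2.smul contMDiffOn_const)).add
      (h3.smul contMDiffOn_const)
  have hcomp : ContMDiffOn J (𝓡 4) ∞
      (fun z => C.Θ.symm (!₂[α z, β z, C.Θ (ρ (f z)) 2, C.Θ (ρ (f z)) 3])) s' :=
    C.contMDiffOn_symm.comp hslice fun z hz => (hformula z hz).1
  have hz₀' : z₀ ∈ s' := ⟨hz₀, hp₀W⟩
  have key : ContMDiffWithinAt J (𝓡 4) ∞ (fun z => tp (ρ (f z)) (α z) (β z)) s' z₀ :=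
    (hcomp z₀ hz₀').congr (fun z hz => (hformula z hz).2) (hformula z₀ hz₀').2
  exact key.mono_of_mem_nhdsWithin hs'n

/-- The tube parametrisation `(x, (a, b)) ↦ tp (ρ x) a b` is continuous on `O × D_rt`. -/
theorem continuousOn_tp_uncurry (hTS : TubeStructure S₀ F u v ρ O Ot rt tp)
    (hfr : NormalFrame F u v ρ U O) :
    ContinuousOn (fun z : X × (ℝ × ℝ) => tp (ρ z.1) z.2.1 z.2.2)
      (O ×ˢ {c : ℝ × ℝ | c.1 ^ 2 + c.2 ^ 2 < rt ^ 2}) := by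
  have h := contMDiffOn_tp_comp hTS hfr (J := (𝓡 4).prod (𝓘(ℝ, ℝ).prod 𝓘(ℝ, ℝ)))
    (N := X × (ℝ × ℝ)) (s := O ×ˢ {c : ℝ × ℝ | c.1 ^ 2 + c.2 ^ 2 < rt ^ 2})
    (f := Prod.fst) (α := fun z => z.2.1) (β := fun z => z.2.2)
    contMDiffOn_fst (contMDiff_fst.comp contMDiff_snd).contMDiffOn
    (contMDiff_snd.comp contMDiff_snd).contMDiffOn (fun z hz => hz.1) fun z hz => by
      have h : z.2 ∈ {c : ℝ × ℝ | c.1 ^ 2 + c.2 ^ 2 < rt ^ 2} := hz.2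
      exact h
  exact h.continuousOn

/-- **The closed tube is a continuous image of `F × D̄_s`**:
`{x ∈ Ot | u² + v² ≤ s²} = tp (ρ ·, ·, ·) '' (F × {a² + b² ≤ s²})` for `s < rt`. -/
theorem closedTube_eq_image (hTS : TubeStructure S₀ F u v ρ O Ot rt tp) (hfr : NormalFrame F u v ρ U O)
    {s : ℝ} (hs : s < rt) (hs0 : 0 ≤ s) :
    {x | x ∈ Ot ∧ u x ^ 2 + v x ^ 2 ≤ s ^ 2} =
      (fun z : X × (ℝ × ℝ) => tp (ρ z.1) z.2.1 z.2.2) '' (F ×ˢ {c : ℝ × ℝ | c.1 ^ 2 + c.2 ^ 2 ≤ s ^ 2}) := by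
  have hss : s ^ 2 < rt ^ 2 := by nlinarith [hTS.rt_pos]
  ext x
  constructor
  · rintro ⟨hxOt, hx⟩
    refine ⟨(ρ x, (u x, v x)), mk_mem_prod (hfr.ρ_mem x (hTS.subset_O hxOt)) ?_, ?_⟩
    · show u x ^ 2 + v x ^ 2 ≤ s ^ 2
      exact hx
    · show tp (ρ (ρ x)) (u x) (v x) = x
      rw [hfr.ρ_ρ (hTS.subset_O hxOt)]
      exact hTS.tp_self x hxOt
  · rintro ⟨⟨p, a, b⟩, ⟨hpF, hab⟩, rfl⟩
    have hab' : a ^ 2 + b ^ 2 < rt ^ 2 := lt_of_le_of_lt hab hss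
    have hρp : ρ p = p := hfr.ρ_eq_self_of_mem hpF
    simp only [hρp]
    exact ⟨hTS.tp_mem p hpF a b hab', by rw [hTS.u_tp p hpF a b hab', hTS.v_tp p hpF a b hab']; exact hab⟩

/-- **Closed tubes are compact** (`s < rt`). -/
theorem isCompact_closedTube [T2Space X] (hTS : TubeStructure S₀ F u v ρ O Ot rt tp)
    (hfr : NormalFrame F u v ρ U O) {s : ℝ} (hs : s < rt) (hs0 : 0 ≤ s) :
    IsCompact {x | x ∈ Ot ∧ u x ^ 2 + v x ^ 2 ≤ s ^ 2} := by
  rw [closedTube_eq_image hTS hfr hs hs0]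
  have hss : s ^ 2 < rt ^ 2 := by nlinarith [hTS.rt_pos]
  have hD : IsCompact {c : ℝ × ℝ | c.1 ^ 2 + c.2 ^ 2 ≤ s ^ 2} := by
    apply Metric.isCompact_of_isClosed_isBounded
    · exact isClosed_le ((continuous_fst.pow 2).add (continuous_snd.pow 2)) continuous_const
    · refine (Metric.isBounded_closedBall (x := (0 : ℝ × ℝ)) (r := s)).subset fun c hc => ?_
      rw [mem_closedBall_zero_iff, Prod.norm_def, max_le_iff, Real.norm_eq_abs, Real.norm_eq_abs]
      have hc' : c.1 ^ 2 + c.2 ^ 2 ≤ s ^ 2 := hc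
      constructor
      · exact abs_le_of_sq_le_sq' (by nlinarith [sq_nonneg c.2]) hs0 |> fun h => abs_le.2 h
      · exact abs_le_of_sq_le_sq' (by nlinarith [sq_nonneg c.1]) hs0 |> fun h => abs_le.2 h
  refine (hfr.isCompact_F.prod hD).image_of_continuousOn ?_
  exact (continuousOn_tp_uncurry hTS hfr).mono
    (prod_mono hfr.F_subset_O fun c (hc : c.1 ^ 2 + c.2 ^ 2 ≤ s ^ 2) => lt_of_le_of_lt hc hss)

/-- Closed tubes are closed. -/
theorem isClosed_closedTube [T2Space X] (hTS : TubeStructure S₀ F u v ρ O Ot rt tp)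
    (hfr : NormalFrame F u v ρ U O) {s : ℝ} (hs : s < rt) (hs0 : 0 ≤ s) :
    IsClosed {x | x ∈ Ot ∧ u x ^ 2 + v x ^ 2 ≤ s ^ 2} :=
  (isCompact_closedTube hTS hfr hs hs0).isClosed

/-- **The closure of an open tube lies in the closed tube** (no far frontier): for `s < rt`,
`closure (tubeSet Ot u v s) ⊆ {x ∈ Ot | u² + v² ≤ s²}`. -/
theorem closure_tubeSet_subset [T2Space X] (hTS : TubeStructure S₀ F u v ρ O Ot rt tp)
    (hfr : NormalFrame F u v ρ U O) {s : ℝ} (hs : s < rt) (hs0 : 0 ≤ s) :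
    closure (tubeSet Ot u v s) ⊆ {x | x ∈ Ot ∧ u x ^ 2 + v x ^ 2 ≤ s ^ 2} :=
  closure_minimal (fun _ hx => ⟨hx.1, hx.2.le⟩) (isClosed_closedTube hTS hfr hs hs0)

/-- The open tube is open. -/
theorem isOpen_tubeSet (hTS : TubeStructure S₀ F u v ρ O Ot rt tp) (hfr : NormalFrame F u v ρ U O)
    (s : ℝ) : IsOpen (tubeSet Ot u v s) :=
  hTS.isOpen.inter (isOpen_lt ((hfr.contMDiff_u.continuous.pow 2).add
    (hfr.contMDiff_v.continuous.pow 2)) continuous_const)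

end Tube

/-! ## The explicit seam flow in the tube -/

section Flow

variable {X : Type}

/-- **The explicit seam flow in the tube**: `tubeFlow m u v ρ tp x t = tp (ρ x) (u', v')` where
`(u', v')` has seam coordinates `(p, q - t / (2 p))`, `(p, q)` being those of `(u x, v x)`
(so that `σ_m = -2 p q` moves at unit speed). -/
def tubeFlow (m : Fin 3) (u v : X → ℝ) (ρ : X → X) (tp : X → ℝ → ℝ → X) (x : X) (t : ℝ) : X :=
  tp (ρ x) (uOfPQ m (pCo m (u x) (v x)) (qCo m (u x) (v x) - t / (2 * pCo m (u x) (v x))))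
    (vOfPQ m (pCo m (u x) (v x)) (qCo m (u x) (v x) - t / (2 * pCo m (u x) (v x))))

/-- The new normal coordinates of the explicit flow: `u' = u x - s e₁`, `v' = v x - s e₂` with
`s = t / (2 p)` and `(e₁, e₂)` the unit `q`-direction. -/
theorem tubeFlow_coords (m : Fin 3) (u v : X → ℝ) (x : X) (t : ℝ) :
    uOfPQ m (pCo m (u x) (v x)) (qCo m (u x) (v x) - t / (2 * pCo m (u x) (v x))) =
      u x - t / (2 * pCo m (u x) (v x)) * uOfPQ m 0 1 ∧
    vOfPQ m (pCo m (u x) (v x)) (qCo m (u x) (v x) - t / (2 * pCo m (u x) (v x))) =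
      v x - t / (2 * pCo m (u x) (v x)) * vOfPQ m 0 1 := by
  rw [uOfPQ_sub, vOfPQ_sub, uOfPQ_pCo_qCo, vOfPQ_pCo_qCo]
  exact ⟨rfl, rfl⟩

/-- **Radius control of the explicit flow**: if `u x² + v x² < R²` and `|t / (2p)| ≤ d` then the
new coordinates satisfy `u'² + v'² < (R + d)²`. -/
theorem sq_tubeFlow_lt (m : Fin 3) (u v : X → ℝ) (x : X) (t : ℝ) {R d : ℝ} (hR : 0 ≤ R)
    (hx : u x ^ 2 + v x ^ 2 < R ^ 2) (hd : |t / (2 * pCo m (u x) (v x))| ≤ d) :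
    uOfPQ m (pCo m (u x) (v x)) (qCo m (u x) (v x) - t / (2 * pCo m (u x) (v x))) ^ 2 +
      vOfPQ m (pCo m (u x) (v x)) (qCo m (u x) (v x) - t / (2 * pCo m (u x) (v x))) ^ 2 <
      (R + d) ^ 2 := by
  rw [(tubeFlow_coords m u v x t).1, (tubeFlow_coords m u v x t).2]
  exact sq_shift_lt (dir_sq m) hR hx hd

variable [TopologicalSpace X] [ChartedSpace (EuclideanSpace ℝ (Fin 4)) X]
  {S₀ F : Set X} {u v : X → ℝ} {ρ : X → X} {U O Ot : Set X} {rt : ℝ} {tp : X → ℝ → ℝ → X}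
  {m : Fin 3}

/-- **The explicit flow, evaluated**: for `x ∈ Ot` and new coordinates in the disc, the point
`tubeFlow m u v ρ tp x t` lies in `Ot`, has the same `ρ`, and has the predicted `u, v, p, q`. -/
theorem tubeFlow_spec (hTS : TubeStructure S₀ F u v ρ O Ot rt tp) (hfr : NormalFrame F u v ρ U O)
    {x : X} (hx : x ∈ Ot) {t : ℝ}
    (hd : uOfPQ m (pCo m (u x) (v x)) (qCo m (u x) (v x) - t / (2 * pCo m (u x) (v x))) ^ 2 +
      vOfPQ m (pCo m (u x) (v x)) (qCo m (u x) (v x) - t / (2 * pCo m (u x) (v x))) ^ 2 < rt ^ 2) :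
    tubeFlow m u v ρ tp x t ∈ Ot ∧ ρ (tubeFlow m u v ρ tp x t) = ρ x ∧
      u (tubeFlow m u v ρ tp x t) =
        uOfPQ m (pCo m (u x) (v x)) (qCo m (u x) (v x) - t / (2 * pCo m (u x) (v x))) ∧
      v (tubeFlow m u v ρ tp x t) =
        vOfPQ m (pCo m (u x) (v x)) (qCo m (u x) (v x) - t / (2 * pCo m (u x) (v x))) ∧
      pCo m (u (tubeFlow m u v ρ tp x t)) (v (tubeFlow m u v ρ tp x t)) = pCo m (u x) (v x) ∧
      qCo m (u (tubeFlow m u v ρ tp x t)) (v (tubeFlow m u v ρ tp x t)) =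
        qCo m (u x) (v x) - t / (2 * pCo m (u x) (v x)) := by
  have hρ : ρ x ∈ F := hfr.ρ_mem x (hTS.subset_O hx)
  have hu := hTS.u_tp _ hρ _ _ hd
  have hv := hTS.v_tp _ hρ _ _ hd
  refine ⟨hTS.tp_mem _ hρ _ _ hd, hTS.ρ_tp _ hρ _ _ hd, hu, hv, ?_, ?_⟩
  · unfold tubeFlow; rw [hu, hv, pCo_uOfPQ_vOfPQ]
  · unfold tubeFlow; rw [hu, hv, qCo_uOfPQ_vOfPQ]

/-- At time `0` the explicit flow is the identity on `Ot`. -/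
theorem tubeFlow_zero (hTS : TubeStructure S₀ F u v ρ O Ot rt tp) {x : X} (hx : x ∈ Ot) :
    tubeFlow m u v ρ tp x 0 = x := by
  unfold tubeFlow
  rw [zero_div, sub_zero, uOfPQ_pCo_qCo, vOfPQ_pCo_qCo, hTS.tp_self x hx]

/-- **Group law of the explicit flow** (valid as soon as the intermediate point is in range). -/
theorem tubeFlow_add (hTS : TubeStructure S₀ F u v ρ O Ot rt tp) (hfr : NormalFrame F u v ρ U O)
    {x : X} (hx : x ∈ Ot) {t : ℝ}
    (hd : uOfPQ m (pCo m (u x) (v x)) (qCo m (u x) (v x) - t / (2 * pCo m (u x) (v x))) ^ 2 +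
      vOfPQ m (pCo m (u x) (v x)) (qCo m (u x) (v x) - t / (2 * pCo m (u x) (v x))) ^ 2 < rt ^ 2)
    (t' : ℝ) : tubeFlow m u v ρ tp (tubeFlow m u v ρ tp x t) t' = tubeFlow m u v ρ tp x (t + t') := by
  obtain ⟨-, hρ, -, -, hp, hq⟩ := tubeFlow_spec hTS hfr hx hd
  generalize tubeFlow m u v ρ tp x t = y at hρ hp hq
  unfold tubeFlow
  rw [hρ, hp, hq, show qCo m (u x) (v x) - t / (2 * pCo m (u x) (v x)) - t' / (2 * pCo m (u x) (v x)) =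
    qCo m (u x) (v x) - (t + t') / (2 * pCo m (u x) (v x)) by ring]

/-- In the box where `σ = -2 p q`, the explicit flow moves `σ` at unit speed:
`-2 p (q - t / (2 p)) = -2 p q + t` (`p ≠ 0`). -/
theorem sigma_model (p q t : ℝ) (hp : p ≠ 0) : -2 * p * (q - t / (2 * p)) = -2 * p * q + t := by
  field_simp
  ring

/-- **Joint smoothness of the explicit flow** on
`{(x, t) | x ∈ Ot, p x ≠ 0, (u', v') ∈ D_rt}`. -/
theorem contMDiffOn_tubeFlow (hTS : TubeStructure S₀ F u v ρ O Ot rt tp) (hfr : NormalFrame F u v ρ U O) :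
    ContMDiffOn ((𝓡 4).prod 𝓘(ℝ, ℝ)) (𝓡 4) ∞ (uncurry (tubeFlow m u v ρ tp))
      {z : X × ℝ | z.1 ∈ Ot ∧ pCo m (u z.1) (v z.1) ≠ 0 ∧
        uOfPQ m (pCo m (u z.1) (v z.1)) (qCo m (u z.1) (v z.1) - z.2 / (2 * pCo m (u z.1) (v z.1))) ^ 2 +
        vOfPQ m (pCo m (u z.1) (v z.1)) (qCo m (u z.1) (v z.1) - z.2 / (2 * pCo m (u z.1) (v z.1))) ^ 2
          < rt ^ 2} := by
  -- the seam coordinates along `fst`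
  have huv : ContMDiff ((𝓡 4).prod 𝓘(ℝ, ℝ)) 𝓘(ℝ, ℝ × ℝ) ∞ fun z : X × ℝ => (u z.1, v z.1) :=
    (hfr.contMDiff_u.comp contMDiff_fst).prodMk_space (hfr.contMDiff_v.comp contMDiff_fst)
  have hP : ContMDiff ((𝓡 4).prod 𝓘(ℝ, ℝ)) 𝓘(ℝ, ℝ) ∞ fun z : X × ℝ => pCo m (u z.1) (v z.1) :=
    (contDiff_pCo m).comp_contMDiff huv
  have hQ : ContMDiff ((𝓡 4).prod 𝓘(ℝ, ℝ)) 𝓘(ℝ, ℝ) ∞ fun z : X × ℝ => qCo m (u z.1) (v z.1) :=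
    (contDiff_qCo m).comp_contMDiff huv
  set D : Set (X × ℝ) := {z : X × ℝ | z.1 ∈ Ot ∧ pCo m (u z.1) (v z.1) ≠ 0 ∧
    uOfPQ m (pCo m (u z.1) (v z.1)) (qCo m (u z.1) (v z.1) - z.2 / (2 * pCo m (u z.1) (v z.1))) ^ 2 +
    vOfPQ m (pCo m (u z.1) (v z.1)) (qCo m (u z.1) (v z.1) - z.2 / (2 * pCo m (u z.1) (v z.1))) ^ 2
      < rt ^ 2} with hD
  have hq' : ContMDiffOn ((𝓡 4).prod 𝓘(ℝ, ℝ)) 𝓘(ℝ, ℝ) ∞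
      (fun z : X × ℝ => qCo m (u z.1) (v z.1) - z.2 / (2 * pCo m (u z.1) (v z.1))) D :=
    hQ.contMDiffOn.sub (contMDiffOn_snd.div₀ (contMDiffOn_const.mul hP.contMDiffOn)
      fun z hz => mul_ne_zero two_ne_zero hz.2.1)
  have hpq : ContMDiffOn ((𝓡 4).prod 𝓘(ℝ, ℝ)) 𝓘(ℝ, ℝ × ℝ) ∞
      (fun z : X × ℝ => (pCo m (u z.1) (v z.1),
        qCo m (u z.1) (v z.1) - z.2 / (2 * pCo m (u z.1) (v z.1)))) D :=
    hP.contMDiffOn.prodMk_space hq'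
  have hα : ContMDiffOn ((𝓡 4).prod 𝓘(ℝ, ℝ)) 𝓘(ℝ, ℝ) ∞ (fun z : X × ℝ =>
      uOfPQ m (pCo m (u z.1) (v z.1)) (qCo m (u z.1) (v z.1) - z.2 / (2 * pCo m (u z.1) (v z.1)))) D :=
    fun z hz => (contDiff_uOfPQ m).comp_contMDiffWithinAt (hpq z hz)
  have hβ : ContMDiffOn ((𝓡 4).prod 𝓘(ℝ, ℝ)) 𝓘(ℝ, ℝ) ∞ (fun z : X × ℝ =>
      vOfPQ m (pCo m (u z.1) (v z.1)) (qCo m (u z.1) (v z.1) - z.2 / (2 * pCo m (u z.1) (v z.1)))) D :=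
    fun z hz => (contDiff_vOfPQ m).comp_contMDiffWithinAt (hpq z hz)
  exact contMDiffOn_tp_comp hTS hfr contMDiffOn_fst hα hβ (fun z hz => hTS.subset_O hz.1)
    fun z hz => hz.2.2

end Flow

/-! ## The registered helper stub -/

/-- **The tube toolkit** (registered helper stub `stub_seamFlowTubeToolkit` of `stub_seamFlow`):
for a tube structure of a normal frame, closed tubes `{x ∈ Ot | u² + v² ≤ s²}` (`0 ≤ s < rt`) are
compact and contain the closure of the open tube `T(s)`; the explicit seam flow `tubeFlow` is
jointly smooth where defined, is the identity at time `0`, and satisfies the group law; open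
tubes are open; radius control of the explicit flow; two table inequalities/identities. -/
def SeamFlowTubeToolkit : Prop :=
  ∀ (X : Type) [TopologicalSpace X] [T2Space X] [ChartedSpace (EuclideanSpace ℝ (Fin 4)) X]
    (S₀ F : Set X) (u v : X → ℝ) (ρ : X → X) (U O Ot : Set X) (rt : ℝ) (tp : X → ℝ → ℝ → X)
    (m : Fin 3), TubeStructure S₀ F u v ρ O Ot rt tp → NormalFrame F u v ρ U O →
    (∀ s : ℝ, s < rt → 0 ≤ s → IsCompact {x | x ∈ Ot ∧ u x ^ 2 + v x ^ 2 ≤ s ^ 2} ∧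
      closure (tubeSet Ot u v s) ⊆ {x | x ∈ Ot ∧ u x ^ 2 + v x ^ 2 ≤ s ^ 2}) ∧
    ContMDiffOn ((𝓡 4).prod 𝓘(ℝ, ℝ)) (𝓡 4) ∞ (uncurry (tubeFlow m u v ρ tp))
      {z : X × ℝ | z.1 ∈ Ot ∧ pCo m (u z.1) (v z.1) ≠ 0 ∧
        uOfPQ m (pCo m (u z.1) (v z.1)) (qCo m (u z.1) (v z.1) - z.2 / (2 * pCo m (u z.1) (v z.1))) ^ 2 +
        vOfPQ m (pCo m (u z.1) (v z.1)) (qCo m (u z.1) (v z.1) - z.2 / (2 * pCo m (u z.1) (v z.1))) ^ 2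
          < rt ^ 2} ∧
    (∀ x ∈ Ot, tubeFlow m u v ρ tp x 0 = x) ∧
    (∀ x ∈ Ot, ∀ t t' : ℝ,
      uOfPQ m (pCo m (u x) (v x)) (qCo m (u x) (v x) - t / (2 * pCo m (u x) (v x))) ^ 2 +
        vOfPQ m (pCo m (u x) (v x)) (qCo m (u x) (v x) - t / (2 * pCo m (u x) (v x))) ^ 2 < rt ^ 2 →
      tubeFlow m u v ρ tp (tubeFlow m u v ρ tp x t) t' = tubeFlow m u v ρ tp x (t + t')) ∧
    (∀ s : ℝ, IsOpen (tubeSet Ot u v s)) ∧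
    (∀ (x : X) (t R d : ℝ), 0 ≤ R → u x ^ 2 + v x ^ 2 < R ^ 2 → |t / (2 * pCo m (u x) (v x))| ≤ d →
      uOfPQ m (pCo m (u x) (v x)) (qCo m (u x) (v x) - t / (2 * pCo m (u x) (v x))) ^ 2 +
        vOfPQ m (pCo m (u x) (v x)) (qCo m (u x) (v x) - t / (2 * pCo m (u x) (v x))) ^ 2 <
        (R + d) ^ 2) ∧
    (∀ p : ℝ, uOfPQ m p 0 ^ 2 + vOfPQ m p 0 ^ 2 ≤ 2 * p ^ 2) ∧
    (∀ p q t : ℝ, p ≠ 0 → -2 * p * (q - t / (2 * p)) = -2 * p * q + t)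

/-- **Registered helper stub `stub_seamFlowTubeToolkit`.** -/
theorem stub_seamFlowTubeToolkit : SeamFlowTubeToolkit :=
  fun _ _ _ _ _ _ u v _ _ _ _ _ _ m hTS hfr =>
    ⟨fun _ hs hs0 => ⟨isCompact_closedTube hTS hfr hs hs0, closure_tubeSet_subset hTS hfr hs hs0⟩,
      contMDiffOn_tubeFlow hTS hfr, fun _ hx => tubeFlow_zero hTS hx,
      fun _ hx _ t' hd => tubeFlow_add hTS hfr hx hd t', isOpen_tubeSet hTS hfr,
      fun x t _ _ hR hx hd => sq_tubeFlow_lt m u v x t hR hx hd, sq_ray_le m,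
      fun _ _ _ hp => sigma_model _ _ _ hp⟩

end Summit.SmoothPoincare4.SmoothPoincare4.Cruxes.AgkCor6Sufficiency.LpBySphereSystemSurgery

end
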